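import Summits.AnomalousDissipation.AnomalousDissipation.Theorems.SolenoidalFractalHomogenisationLagrangianStepWEvenCertSlotsB
import Summits.AnomalousDissipation.AnomalousDissipation.Theorems.SolenoidalFractalHomogenisationLagrangianStepCellLawVQSPairMemory
import Summits.AnomalousDissipation.AnomalousDissipation.Theorems.SolenoidalFractalHomogenisationLagrangianStepD1Split
import HarnessLib

/-!
# CERT-(i) v0 — residue certificate spine for clause (i) of `WCrossing.D1ExactFamily (ΦB a) ρB MB` (variant A)

Planner `ad-ideate-p5` g13 «profile».  K1L_D item stmt-AnomalousDissipation-27980, registered stub `stub_D1_exactFamily`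
(`…WCrossingWindow`, registry v14/v15).  Design memo: `Lines/onelevel-D1-residue-cert.md` (kit j322277).

Clause (i) of `D1ExactFamily (ΦB a) ρB MB MB_pos` for the exact family `Ψ = (a/a⋆)•psiStar` reads
`RelSmall (Ψ ν S − ΦB a S) (ΦB a S) ρB` on the block window `NearIso S (10/11) (11/10)`, `OddSectorial S τ`, `τ ≤ 1/20`.
With the identification `Ψ ν S − ΦB a S = a • pairQS S + tail ν S` (p1/w1 lane; NOT part of this file) it follows from
  (P) `RelSmall (pairQS S) (excQS cubatureWord MB S) ρP`, `ρP = 115/10⁶` — theorem `relSmall_pairQS`, KERNEL-CHECKED WITHOUT SORRY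
      (v3: numerator `stub_pairNum`, point enclosures `stub_lEncl`, denominator `excDen_of_lEncl`, finite core `stub_core`, composition
      `relSmall_pairQS_of`; axioms = propext / Classical.choice / Quot.sound) — and
  (T) `RelSmall (tail ν S) (ΦB a S) (ρB − ρP)` (`ρB − ρP = 5/10⁶`; the tail is `≤ 10⁻⁹` relative),
via the proved glue `RelSmall.smul'`, `RelSmall.add'`, `clause_i_of_pair_tail`.

THE CHAIN (memo §2): numerator `bsymb (pairQS S)² ≤ N̄(k,p)·N̄(k,q)` from the LANDED matrix lemma `abs_pairForm_le` (floor `10/11`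
via `window_regBlock`, no odd charge) + AM-GM over the 13 adjacent pairs + Cauchy–Schwarz over slots; denominator
`L(k,p) ≤ symb (excQS S)(k,p)` from the LANDED first-order sectorial pinch `OddGain.evenPinch_excQS_design_point'` (charge 3 %;
the S2 route with charge 0.34 % is the documented upgrade); O_h-reduced finite core `N̄ ≤ ρP·L` = `slot_sum_poly` + `I3_eq_of_perp`
+ `I1_le_I2_of_perp` + TWO rational sign conditions (`signConditions`, PROVED) with the 3–4-digit class tables `nC`, `lC` below.

`pairResp`/`pairQ`/`pairQS` are LOCAL MODEL DEFINITIONS (the colinear adjacent-pair memory term of the cubature word, engine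
`pair_map` of `wmargin_cf.py`, p1 `pairForm`); when the Theorems-side decl lands the certificate is re-targeted BY NAME — the chain
uses only the slot structure and `abs_pairForm_le`, so any def of the shape `Σ coef·sym(e⊗e′)⊗(P R P)` with `|vᵀRw| ≤ T K(Tb)²|v||w|`
inherits it (E1 precedent).  v3: the file is SORRY-FREE.
-/

set_option linter.dupNamespace false
set_option linter.unusedVariables false

namespace Summit.AnomalousDissipation.AnomalousDissipation.Cruxes.LagrangianRenormalisationStep.D1ResidueCert

open Summit.AnomalousDissipation.AnomalousDissipation.Theorems
open Summit.AnomalousDissipation.AnomalousDissipation.Theorems.SolenoidalFractalHomogenisation.LagrangianStep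
open Summit.AnomalousDissipation.AnomalousDissipation.Theorems.SolenoidalFractalHomogenisation.LagrangianStep.WCrossing
open Summit.AnomalousDissipation.AnomalousDissipation.Theorems.SolenoidalFractalHomogenisation.LagrangianStep.WEvenCert
open Literature.Analysis Literature.Analysis.FluidPDE Literature.Analysis.FunctionSpaces
open Set Real

noncomputable section

/-! ## §1 The pair-memory tensor of the cubature word (local model definitions) -/

/-- Slot time `T_s = 4π²|m_s|²·M_B·τ_s` (`= T100, T110, T111` by class). -/
def slotT (j : Fin 26) : ℝ :=
  4 * Real.pi ^ 2 * ‖Torus.latticeVec (cubatureWord.phase j).m‖ ^ 2 * MB * (cubatureWord.phase j).τ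

/-- The PAIR-MEMORY response matrix `R_T(B) = T ∫₀¹ a(s) ∫₀¹ a(x) e^{−T(1+s−x)B} dx ds` (`= T·J_T(B)²` by the symmetry of the
trapezoid; the matrix of p1's `pairForm`, cf. `abs_pairForm_le`). -/
def pairResp (ρ T : ℝ) (B : Matrix (Fin 3) (Fin 3) ℝ) : Matrix (Fin 3) (Fin 3) ℝ := fun i j =>
  T * ∫ s in (0:ℝ)..1, LatticeShear.LatticeWord.trapezoid 0 1 ρ s *
    ∫ x in (0:ℝ)..1, LatticeShear.LatticeWord.trapezoid 0 1 ρ x * (NormedSpace.exp (-((T * (1 + s - x)) • B))) i j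

/-- The projected pair response of slot `j` at background `S`: `P_j · R_{T_j}(B̂_j(S)) · P_j`. -/
def pairQ (S : T4) (j : Fin 26) : Matrix (Fin 3) (Fin 3) ℝ :=
  projPerp (mhat (cubatureWord.phase j)) * pairResp cubatureWord.ramp (slotT j) (regBlock S (mhat (cubatureWord.phase j))) *
    projPerp (mhat (cubatureWord.phase j))

/-- First slot `2l` of the `l`-th colinear adjacent pair of the cubature word. -/
def fstSlot (l : Fin 13) : Fin 26 := ⟨2 * l.val, by have := l.isLt; omega⟩

/-- Second slot `2l+1` of the `l`-th colinear adjacent pair (same `m`, same `τ`, orthogonal polarisation). -/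
def sndSlot (l : Fin 13) : Fin 26 := ⟨2 * l.val + 1, by have := l.isLt; omega⟩

/-- THE PAIR-MEMORY TENSOR `pairQS S = Σ_{l<13} slotCoef_{2l} · sym(e_{2l} ⊗ e_{2l+1}) ⊗ (P R P)_{2l}(S)` — the `O(e^{0})` cross-slot
memory of the 13 colinear adjacent pairs (all other pairs are `≤ e^{−T·10/11} ≤ 10⁻¹²`, part of the tail). Index convention of `excQS`:
`(a,b)` carry the polarisations, `(i,j)` the response. -/
def pairQS (S : T4) : T4 := fun i a j b =>
  ∑ l : Fin 13, slotCoef cubatureWord (fstSlot l) *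
    (((cubatureWord.phase (fstSlot l)).e a * (cubatureWord.phase (sndSlot l)).e b +
      (cubatureWord.phase (sndSlot l)).e a * (cubatureWord.phase (fstSlot l)).e b) / 2) * pairQ S (fstSlot l) i j

/-! ## §2 Class constants and the two comparison forms `N̄`, `L` -/

/-- Class table lookup by `M = |m|² ∈ {1,2,3}` (`Mq_cases`). -/
def byClass (X1 X2 X3 M : ℝ) : ℝ := if M = 1 then X1 else if M = 2 then X2 else X3

/-- Upper class constants `n_c ≥ ½ T_c K(T_c·10/11)²` (true values 9.2950e-5, 3.5458e-7, 1.5355e-8; kit j322277). -/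
def nC (j : Fin 26) : ℝ := byClass (93 / 1000000) (36 / 100000000) (16 / 1000000000) (Mq (slots j))

/-- Lower class constants `l_c ≤ (97/100)·f_{T_c}(11/10)` — the denominator of record is the LANDED first-order sectorial pinch
`OddGain.evenPinch_excQS_design_point'` (`0.97·gainForm(11/10)/(11/10) ≤ symb (excQS S)`, charge 3 %); true values 0.2912693,
0.2938690, 0.2939306.  (The S2 second-order route — scalar pinch + `oddEven_qsResp`, charge 0.34 % — would allow
`lC = (299/10³, 3019/10⁴, 3019/10⁴)` and `ρP` down to `111/10⁶`; not needed at `ρB = 3/25000`, memo §2 D2/D2′.) -/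
def lC (j : Fin 26) : ℝ := byClass (2911 / 10000) (2937 / 10000) (2938 / 10000) (Mq (slots j))

/-- The certified residue constant of the pair term: `ρP = 115/10⁶` (`< ρB = 120/10⁶`, tail allowance `ρB − ρP = 5/10⁶`; smallest
certifiable with these tables `≈ 1.1394/10⁴`, with the S2 tables `≈ 1.1092/10⁴`). -/
def ρP : ℝ := 115 / 1000000

/-- `k`-side slot factor `e_j · k`. -/
def ek (j : Fin 26) (k : Fin 3 → ℝ) : ℝ := ∑ a, (cubatureWord.phase j).e a * k a

/-- `p`-side slot factor `|P_j p|²` (`= |p|² − (p·m̂_j)²`, `sum_sq_projPerp_mulVec`). -/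
def PpSq (j : Fin 26) (p : Fin 3 → ℝ) : ℝ := ∑ i, ((projPerp (mhat (cubatureWord.phase j))).mulVec p i) ^ 2

/-- NUMERATOR comparison form `N̄(k,p) = Σ_j slotCoef_j (e_j·k)² · n_{c(j)} |P_j p|²`. -/
def Nbar (k p : Fin 3 → ℝ) : ℝ := ∑ j, slotCoef cubatureWord j * ek j k ^ 2 * (nC j * PpSq j p)

/-- DENOMINATOR comparison form `L(k,p) = Σ_j slotCoef_j (e_j·k)² · l_{c(j)} |P_j p|²`. -/
def Lbar (k p : Fin 3 → ℝ) : ℝ := ∑ j, slotCoef cubatureWord j * ek j k ^ 2 * (lC j * PpSq j p)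

theorem nC_pos (j : Fin 26) : 0 < nC j := by
  unfold nC byClass; split_ifs <;> norm_num

theorem lC_pos (j : Fin 26) : 0 < lC j := by
  unfold lC byClass; split_ifs <;> norm_num

/-- `|P_j p|² = PpM/M` in the integer slot vocabulary of `WEvenCertDefs`. -/
theorem PpSq_eq (j : Fin 26) (p : Fin 3 → ℝ) : PpSq j p = PpM (slots j) p / Mq (slots j) := by
  unfold PpSq
  rw [show projPerp (mhat (cubatureWord.phase j)) = projPerp (nj j) from rfl, sum_sq_projPerp_mulVec (hn_j j) p]
  exact perp_sq j p

/-- The class table divided by `M` is the Lagrange interpolant of `(X1, X2/2, X3/3)` on `M ∈ {1,2,3}`. -/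
theorem byClass_mul_PpSq (X1 X2 X3 : ℝ) (j : Fin 26) (p : Fin 3 → ℝ) :
    byClass X1 X2 X3 (Mq (slots j)) * PpSq j p = qLag X1 (X2 / 2) (X3 / 3) (Mq (slots j)) * PpM (slots j) p := by
  rw [PpSq_eq]; unfold byClass qLag
  rcases Mq_cases j with h | h | h <;> rw [h] <;> norm_num <;> ring

theorem PpSq_nonneg (j : Fin 26) (p : Fin 3 → ℝ) : 0 ≤ PpSq j p := by
  unfold PpSq; exact Finset.sum_nonneg fun i _ => sq_nonneg _

theorem Nbar_nonneg (k p : Fin 3 → ℝ) : 0 ≤ Nbar k p :=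
  Finset.sum_nonneg fun j _ =>
    mul_nonneg (mul_nonneg (slotCoef_nonneg cubatureWord j) (sq_nonneg _)) (mul_nonneg (nC_pos j).le (PpSq_nonneg j p))

theorem Lbar_nonneg (k p : Fin 3 → ℝ) : 0 ≤ Lbar k p :=
  Finset.sum_nonneg fun j _ =>
    mul_nonneg (mul_nonneg (slotCoef_nonneg cubatureWord j) (sq_nonneg _)) (mul_nonneg (lC_pos j).le (PpSq_nonneg j p))

/-- The two rational SIGN CONDITIONS of the O_h-reduced core (`β ≥ 0` at `t = 0`, `α + β ≥ 0` at `t = ½`), with `e_c = ρP·l_c − n_c`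
(values `+1.91·10⁻³`, `+1.02·10⁻⁴`). -/
theorem signConditions :
    0 ≤ 40 * (ρP * (2911 / 10000) - 93 / 1000000) + 80 * (ρP * (2937 / 10000) - 36 / 100000000)
          + 48 * (ρP * (2938 / 10000) - 16 / 1000000000) ∧
    0 ≤ 120 * (ρP * (2911 / 10000) - 93 / 1000000) + 144 * (ρP * (2937 / 10000) - 36 / 100000000)
          + 72 * (ρP * (2938 / 10000) - 16 / 1000000000) := by
  unfold ρP; constructor <;> norm_num

/-! ## §3 The four links — ALL PROVED (v3, no sorry): numerator `stub_pairNum`, point enclosures `stub_lEncl`, denominator `stub_excDen`, finite core `stub_core` -/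

/-- (N) NUMERATOR: `bsymb (pairQS S)(k;p,q)² ≤ N̄(k,p) N̄(k,q)` on the block window — PROVED in §3a: `bsymb_pairQS` (pair by pair),
`form_pairResp`/`form_PRP` (`pᵀ P R P q` = the double-integral form of `abs_pairForm_le`), `abs_pairForm_le'` with floor `10/11` on all of `ℝ³`
(`window_regBlock`), the exponential-free class enclosures `4(11/10)⁴/T_c³ ≤ 2·nC_c` (`crude_le_nC`, `pi_sq_bounds`), AM-GM
`|(e·k)(e′·k)| ≤ ½((e·k)² + (e′·k)²)` pair → slots (`pair_term_le`, `Nbar_eq_pairs`), Cauchy–Schwarz over pairs. -/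
def PairNumBound : Prop :=
  ∀ S : T4, Torus.NearIso S (10 / 11) (11 / 10) → ∀ k p q : Fin 3 → ℝ,
    (Torus.bsymb (pairQS S) k p q) ^ 2 ≤ Nbar k p * Nbar k q

/-- (D) DENOMINATOR: `L(k,p) ≤ symb (excQS S)(k,p)` on the sectorial block window.  PROVED below (`excDen_of_lEncl`) from the LANDED
first-order sectorial pinch `OddGain.evenPinch_excQS_design_point'` + `gainForm_div`, modulo the three point enclosures `LEncl`. -/
def ExcDenBound : Prop :=
  ∀ S : T4, Torus.NearIso S (10 / 11) (11 / 10) → ∀ τ ∈ Set.Icc (0:ℝ) (1 / 20), OddSectorial S τ →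
    ∀ k p : Fin 3 → ℝ, Lbar k p ≤ Torus.symb (excQS cubatureWord MB S) k p

/-- (D-encl) the three LOWER POINT ENCLOSURES `lC_c ≤ (97/100)·f_{T_c}(11/10)`, `f_T(a) = qsRespScalar ½ T a
= (1/3 − 4/X² + 4(3 − 4e^{−X/2} + e^{−X})/X³)/a`, `X = T_c·11/10 ∈ {34.74, 222.3, 633.2}` (`qsRespScalar_eq_closed_form`,
`Real.pi_gt_d4`, `Real.exp_nonneg`, `e^{−X/2} ≤ 1/(1+X/2)`); slack `1.7·10⁻⁴, 1.7·10⁻⁴, 1.3·10⁻⁴` (E1 `stub_N100L` technology). -/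
def LEncl : Prop :=
  ∀ j : Fin 26, lC j ≤ 97 / 100 * qsRespScalar cubatureWord.ramp (slotT j) (11 / 10)

/-- (C) FINITE CORE: `N̄ ≤ ρP·L` on transverse pairs — `slotCoef_mul_sq` + `slot_sum_poly` (class constants `A1 = X₁, A2 = X₂/2,
A3 = X₃/3, B2 = 0`), `sum_sq_projPerp_mulVec`, `I3_eq_of_perp`, `I1_nonneg`, `I1_le_I2_of_perp`, and `signConditions`. -/
def CoreIneq : Prop :=
  ∀ k p : Fin 3 → ℝ, ∑ i, p i * k i = 0 → Nbar k p ≤ ρP * Lbar k p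

/-! ### §3a The numerator (N) is PROVED: pair-form identity, crude bound `abs_pairForm_le'`, class enclosures, AM-GM + Cauchy–Schwarz -/

section PairNum

/-- `slotT = Tj` (the `WEvenCert` slot time). -/
theorem slotT_eq (j : Fin 26) : slotT j = Tj j := by
  show 4 * Real.pi ^ 2 * ‖Torus.latticeVec (slots j).m‖ ^ 2 * MB * ((slots j).τ : ℝ) = _
  rw [norm_sq_m]; rfl

theorem slotT_pos (j : Fin 26) : 0 < slotT j := by rw [slotT_eq]; exact Tj_pos j

/-- Integer pair data: the slots `2l`, `2l+1` share `m` and `τ` (by `decide` on the table). -/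
private theorem pair_data (l : Fin 13) :
    (slots (sndSlot l)).m = (slots (fstSlot l)).m ∧ (slots (sndSlot l)).τ = (slots (fstSlot l)).τ := by
  revert l; unfold fstSlot sndSlot; decide

private theorem nj_snd (l : Fin 13) : nj (sndSlot l) = nj (fstSlot l) := by
  funext a
  show Torus.latticeVec (slots (sndSlot l)).m a / ‖Torus.latticeVec (slots (sndSlot l)).m‖
    = Torus.latticeVec (slots (fstSlot l)).m a / ‖Torus.latticeVec (slots (fstSlot l)).m‖
  rw [(pair_data l).1]

private theorem Mq_snd (l : Fin 13) : Mq (slots (sndSlot l)) = Mq (slots (fstSlot l)) := by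
  unfold Mq; rw [(pair_data l).1]

private theorem slotCoef_snd (l : Fin 13) : slotCoef cubatureWord (sndSlot l) = slotCoef cubatureWord (fstSlot l) := by
  show ((slots (sndSlot l)).τ : ℝ) / (2 * (2 * Real.pi * ‖Torus.latticeVec (slots (sndSlot l)).m‖) ^ 4) / cubatureWord.period
    = ((slots (fstSlot l)).τ : ℝ) / (2 * (2 * Real.pi * ‖Torus.latticeVec (slots (fstSlot l)).m‖) ^ 4) / cubatureWord.period
  rw [(pair_data l).1, (pair_data l).2]

private theorem nC_snd (l : Fin 13) : nC (sndSlot l) = nC (fstSlot l) := by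
  unfold nC; rw [Mq_snd]

private theorem PpSq_snd (l : Fin 13) (p : Fin 3 → ℝ) : PpSq (sndSlot l) p = PpSq (fstSlot l) p := by
  show ∑ i, ((projPerp (nj (sndSlot l))).mulVec p i) ^ 2 = ∑ i, ((projPerp (nj (fstSlot l))).mulVec p i) ^ 2
  rw [nj_snd]

/-- Re-indexing the 26 slots as 13 colinear adjacent pairs. -/
private theorem sum_slots_pairs (f : Fin 26 → ℝ) : ∑ j, f j = ∑ l : Fin 13, (f (fstSlot l) + f (sndSlot l)) := by
  rw [← Equiv.sum_comp (finProdFinEquiv : Fin 13 × Fin 2 ≃ Fin 26) f, Fintype.sum_prod_type]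
  refine Finset.sum_congr rfl fun l _ => ?_
  have h0 : (finProdFinEquiv : Fin 13 × Fin 2 ≃ Fin 26) (l, 0) = fstSlot l := by
    apply Fin.ext; rw [finProdFinEquiv_apply_val]; simp [fstSlot]
  have h1 : (finProdFinEquiv : Fin 13 × Fin 2 ≃ Fin 26) (l, 1) = sndSlot l := by
    apply Fin.ext; rw [finProdFinEquiv_apply_val]; simp [sndSlot]; omega
  rw [Fin.sum_univ_two, h0, h1]

/-- The pair weight `W_l(k) = c_{2l}·((e_{2l}·k)² + (e_{2l+1}·k)²)·nC_{2l}` of the AM-GM step. -/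
def pairW (k : Fin 3 → ℝ) (l : Fin 13) : ℝ :=
  slotCoef cubatureWord (fstSlot l) * (ek (fstSlot l) k ^ 2 + ek (sndSlot l) k ^ 2) * nC (fstSlot l)

theorem pairW_nonneg (k : Fin 3 → ℝ) (l : Fin 13) : 0 ≤ pairW k l :=
  mul_nonneg (mul_nonneg (slotCoef_nonneg _ _) (add_nonneg (sq_nonneg _) (sq_nonneg _))) (nC_pos _).le

/-- `N̄` summed over pairs. -/
theorem Nbar_eq_pairs (k r : Fin 3 → ℝ) : Nbar k r = ∑ l, pairW k l * PpSq (fstSlot l) r := by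
  unfold Nbar
  rw [sum_slots_pairs]
  refine Finset.sum_congr rfl fun l _ => ?_
  rw [slotCoef_snd, nC_snd, PpSq_snd]; unfold pairW; ring

/-- The bilinear symbol of ONE symmetrised pair tensor `c · sym(e ⊗ e') ⊗ Q`: `c (e·k)(e'·k) · pᵀ Q q`. -/
private theorem bsymb_pairslot (c : ℝ) (e e' : Fin 3 → ℝ) (Q : Matrix (Fin 3) (Fin 3) ℝ) (κ p q : Fin 3 → ℝ) :
    Torus.bsymb (fun i a j b => c * ((e a * e' b + e' a * e b) / 2) * Q i j) κ p q
      = c * ((∑ a, e a * κ a) * (∑ a, e' a * κ a)) * ∑ i, ∑ j, p i * Q i j * q j := by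
  unfold Torus.bsymb
  simp only [Fin.sum_univ_three]
  ring

/-- **The bilinear symbol of `pairQS`, pair by pair.** -/
theorem bsymb_pairQS (S : T4) (κ p q : Fin 3 → ℝ) :
    Torus.bsymb (pairQS S) κ p q = ∑ l : Fin 13, slotCoef cubatureWord (fstSlot l) * (ek (fstSlot l) κ * ek (sndSlot l) κ) *
      ∑ i, ∑ j, p i * pairQ S (fstSlot l) i j * q j := by
  have hfun : pairQS S = ∑ l : Fin 13, fun i a j b => slotCoef cubatureWord (fstSlot l) *
      (((cubatureWord.phase (fstSlot l)).e a * (cubatureWord.phase (sndSlot l)).e b +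
        (cubatureWord.phase (sndSlot l)).e a * (cubatureWord.phase (fstSlot l)).e b) / 2) * pairQ S (fstSlot l) i j := by
    funext i a j b; simp only [pairQS, Finset.sum_apply]
  rw [hfun, bsymb_finsetSum]
  exact Finset.sum_congr rfl fun l _ => bsymb_pairslot _ _ _ _ κ p q

/-- Joint continuity of the pair kernel entries `(s, x) ↦ (e^{−T(1+s−x)B})ᵢⱼ`. -/
private theorem continuous_pairKernel_apply (T : ℝ) (B : Matrix (Fin 3) (Fin 3) ℝ) (i j : Fin 3) :
    Continuous fun p : ℝ × ℝ => (NormedSpace.exp (-((T * (1 + p.1 - p.2)) • B))) i j := by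
  have h := (continuous_exp_smul_apply B i j).comp (by fun_prop : Continuous fun p : ℝ × ℝ => -(T * (1 + p.1 - p.2)))
  refine h.congr fun p => ?_
  simp only [Function.comp_apply, neg_smul]

/-- Finite double sums with constant coefficients commute with the interval integral (copy of the private `CellLawVQSResp` tool). -/
private theorem integral_sum_sum_mul' {f : Fin 3 → Fin 3 → ℝ → ℝ} {a b : ℝ} (c : Fin 3 → Fin 3 → ℝ)
    (hf : ∀ i j, IntervalIntegrable (f i j) MeasureTheory.volume a b) :
    ∫ x in a..b, ∑ i, ∑ j, c i j * f i j x = ∑ i, ∑ j, c i j * ∫ x in a..b, f i j x := by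
  rw [intervalIntegral.integral_finsetSum]
  · refine Finset.sum_congr rfl fun i _ => ?_
    rw [intervalIntegral.integral_finsetSum]
    · exact Finset.sum_congr rfl fun j _ => intervalIntegral.integral_const_mul _ _
    · exact fun j _ => (hf i j).const_mul _
  · intro i _
    have h := IntervalIntegrable.sum Finset.univ fun j (_ : j ∈ Finset.univ) => (hf i j).const_mul (c i j)
    rw [Finset.sum_fn] at h
    exact h

/-- **The bilinear form of `pairResp` is the double integral of the bilinear form of the pair kernel** (the form of `abs_pairForm_le`). -/
theorem form_pairResp (ρ T : ℝ) (B : Matrix (Fin 3) (Fin 3) ℝ) (v w : Fin 3 → ℝ) :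
    ∑ i, ∑ j, v i * pairResp ρ T B i j * w j =
      T * ∫ s in (0:ℝ)..1, LatticeShear.LatticeWord.trapezoid 0 1 ρ s *
        ∫ x in (0:ℝ)..1, LatticeShear.LatticeWord.trapezoid 0 1 ρ x *
          ∑ i, v i * (NormedSpace.exp (-((T * (1 + s - x)) • B))).mulVec w i := by
  simp_rw [sum_mul_mulVec_eq_sum_sum]
  set α : ℝ → ℝ := fun s => LatticeShear.LatticeWord.trapezoid 0 1 ρ s with hα
  set E : ℝ → ℝ → Fin 3 → Fin 3 → ℝ := fun s x i j => (NormedSpace.exp (-((T * (1 + s - x)) • B))) i j with hE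
  have hin : ∀ i j s, IntervalIntegrable (fun x => α x * E s x i j) MeasureTheory.volume 0 1 := fun i j s =>
    ((continuous_trapezoid_unit ρ).mul
      ((continuous_pairKernel_apply T B i j).comp (continuous_const.prodMk continuous_id))).intervalIntegrable _ _
  have hout : ∀ i j, IntervalIntegrable (fun s => α s * ∫ x in (0:ℝ)..1, α x * E s x i j) MeasureTheory.volume 0 1 := by
    intro i j
    have hf : Continuous (Function.uncurry fun s x : ℝ => α x * E s x i j) :=
      ((continuous_trapezoid_unit ρ).comp continuous_snd).mul (continuous_pairKernel_apply T B i j)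
    exact ((continuous_trapezoid_unit ρ).mul
      (intervalIntegral.continuous_parametric_intervalIntegral_of_continuous' hf 0 1)).intervalIntegrable _ _
  have hinner : ∀ s, ∫ x in (0:ℝ)..1, α x * ∑ i, ∑ j, v i * E s x i j * w j
      = ∑ i, ∑ j, (v i * w j) * ∫ x in (0:ℝ)..1, α x * E s x i j := by
    intro s
    rw [← integral_sum_sum_mul' (fun i j => v i * w j) fun i j => hin i j s]
    refine intervalIntegral.integral_congr fun x _ => ?_
    show α x * ∑ i, ∑ j, v i * E s x i j * w j = ∑ i, ∑ j, (v i * w j) * (α x * E s x i j)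
    rw [Finset.mul_sum]
    refine Finset.sum_congr rfl fun i _ => ?_
    rw [Finset.mul_sum]
    refine Finset.sum_congr rfl fun j _ => ?_
    ring
  have houter : ∫ s in (0:ℝ)..1, α s * ∫ x in (0:ℝ)..1, α x * ∑ i, ∑ j, v i * E s x i j * w j
      = ∑ i, ∑ j, (v i * w j) * ∫ s in (0:ℝ)..1, α s * ∫ x in (0:ℝ)..1, α x * E s x i j := by
    rw [← integral_sum_sum_mul' (fun i j => v i * w j) hout]
    refine intervalIntegral.integral_congr fun s _ => ?_
    show α s * (∫ x in (0:ℝ)..1, α x * ∑ i, ∑ j, v i * E s x i j * w j)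
      = ∑ i, ∑ j, (v i * w j) * (α s * ∫ x in (0:ℝ)..1, α x * E s x i j)
    rw [hinner s, Finset.mul_sum]
    refine Finset.sum_congr rfl fun i _ => ?_
    rw [Finset.mul_sum]
    refine Finset.sum_congr rfl fun j _ => ?_
    ring
  simp only [pairResp]
  rw [houter, Finset.mul_sum]
  refine Finset.sum_congr rfl fun i _ => ?_
  rw [Finset.mul_sum]
  refine Finset.sum_congr rfl fun j _ => ?_
  ring

/-- `pᵀ (P R P) q = (Pp)ᵀ R (Pq)` for a symmetric `P`. -/
private theorem form_PRP (P R : Matrix (Fin 3) (Fin 3) ℝ) (hP : P.transpose = P) (p q : Fin 3 → ℝ) :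
    ∑ i, ∑ j, p i * (P * R * P) i j * q j = ∑ i, ∑ j, P.mulVec p i * R i j * P.mulVec q j := by
  have h : dotProduct p ((P * R * P).mulVec q) = dotProduct (P.mulVec p) (R.mulVec (P.mulVec q)) := by
    rw [← Matrix.mulVec_mulVec, ← Matrix.mulVec_mulVec, Matrix.dotProduct_mulVec, ← Matrix.mulVec_transpose, hP]
  rw [← sum_mul_mulVec_eq_sum_sum, ← sum_mul_mulVec_eq_sum_sum]
  exact h

/-- The regularised block is `10/11`-coercive on ALL of `ℝ³` on the window `NearIso S (10/11) (11/10)` (`window_regBlock`). -/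
private theorem regBlock_coercive {S : T4} (hS : Torus.NearIso S (10 / 11) (11 / 10)) (s : Fin 26) (y : Fin 3 → ℝ) :
    10 / 11 * ∑ i, y i ^ 2 ≤ ∑ i, ∑ j, y i * regBlock S (nj s) i j * y j := by
  have h := (window_regBlock (hn_j s) hS (by norm_num) (by norm_num) y).1
  rw [← sum_mul_mulVec_eq_sum_sum]
  have e1 : dotProduct y y = ∑ i, y i ^ 2 := Finset.sum_congr rfl fun i _ => by ring
  rw [← e1]; exact h

/-- **Per-slot crude bound of the projected pair form**: `|pᵀ(P R P)q| ≤ |Pp||Pq|/(ρ²T³(10/11)⁴)`. -/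
theorem abs_form_pairQ_le {S : T4} (hS : Torus.NearIso S (10 / 11) (11 / 10)) (s : Fin 26) (p q : Fin 3 → ℝ) :
    |∑ i, ∑ j, p i * pairQ S s i j * q j|
      ≤ 1 / ((1 / 2) ^ 2 * slotT s ^ 3 * (10 / 11) ^ 4) * (Real.sqrt (PpSq s p) * Real.sqrt (PpSq s q)) := by
  have hP := WEvenCert.projPerp_transpose (nj s)
  unfold pairQ PpSq
  rw [show mhat (cubatureWord.phase s) = nj s from rfl, show cubatureWord.ramp = (1 / 2 : ℝ) from rfl,
    form_PRP _ _ hP, form_pairResp]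
  exact abs_pairForm_le' (regBlock S (nj s)) (by norm_num) (by norm_num) (slotT_pos s) (regBlock_coercive hS s) _ _

/-- **Class enclosures of the crude constant**: `4(11/10)⁴/T_c³ ≤ 2·nC_c` (`T_c ≥ 31.582, 202.12, 575.5` from `π² ≥ 9.8696044`). -/
theorem crude_le_nC (s : Fin 26) : 1 / ((1 / 2) ^ 2 * slotT s ^ 3 * (10 / 11) ^ 4) ≤ 2 * nC s := by
  rw [slotT_eq]
  obtain ⟨hlo, -⟩ := pi_sq_bounds
  rcases slot_class s with hj | hj | hj
  · obtain ⟨hM, hTj, -⟩ := facts100 s hj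
    have hn : nC s = 93 / 1000000 := by unfold nC byClass; rw [hM]; norm_num
    rw [hn, hTj]; unfold T100 MB
    have hX : (31582 / 1000 : ℝ) ≤ 4 * π ^ 2 * 1 * (1 / 50) * 40 := by nlinarith
    calc 1 / ((1 / 2) ^ 2 * (4 * π ^ 2 * 1 * (1 / 50) * 40) ^ 3 * (10 / 11) ^ 4)
        ≤ 1 / ((1 / 2) ^ 2 * (31582 / 1000 : ℝ) ^ 3 * (10 / 11) ^ 4) := by
          apply one_div_le_one_div_of_le (by norm_num); gcongr
      _ ≤ 2 * (93 / 1000000) := by norm_num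
  · obtain ⟨hM, hTj, -, -, -, -⟩ := facts110 s hj
    have hn : nC s = 36 / 100000000 := by unfold nC byClass; rw [hM]; norm_num
    rw [hn, hTj]; unfold T110 MB
    have hX : (20212 / 100 : ℝ) ≤ 4 * π ^ 2 * 2 * (1 / 50) * 128 := by nlinarith
    calc 1 / ((1 / 2) ^ 2 * (4 * π ^ 2 * 2 * (1 / 50) * 128) ^ 3 * (10 / 11) ^ 4)
        ≤ 1 / ((1 / 2) ^ 2 * (20212 / 100 : ℝ) ^ 3 * (10 / 11) ^ 4) := by
          apply one_div_le_one_div_of_le (by norm_num); gcongr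
      _ ≤ 2 * (36 / 100000000) := by norm_num
  · obtain ⟨hM, hTj, -⟩ := facts111 s hj
    have hn : nC s = 16 / 1000000000 := by unfold nC byClass; rw [hM]; norm_num
    rw [hn, hTj]; unfold T111 MB
    have hX : (5755 / 10 : ℝ) ≤ 4 * π ^ 2 * 3 * (1 / 50) * 243 := by nlinarith
    calc 1 / ((1 / 2) ^ 2 * (4 * π ^ 2 * 3 * (1 / 50) * 243) ^ 3 * (10 / 11) ^ 4)
        ≤ 1 / ((1 / 2) ^ 2 * (5755 / 10 : ℝ) ^ 3 * (10 / 11) ^ 4) := by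
          apply one_div_le_one_div_of_le (by norm_num); gcongr
      _ ≤ 2 * (16 / 1000000000) := by norm_num

/-- AM-GM per pair: `|c (e·k)(e'·k) F| ≤ W_l · |Pp| |Pq|`. -/
private theorem pair_term_le {S : T4} (hS : Torus.NearIso S (10 / 11) (11 / 10)) (k p q : Fin 3 → ℝ) (l : Fin 13) :
    |slotCoef cubatureWord (fstSlot l) * (ek (fstSlot l) k * ek (sndSlot l) k) * ∑ i, ∑ j, p i * pairQ S (fstSlot l) i j * q j|
      ≤ pairW k l * (Real.sqrt (PpSq (fstSlot l) p) * Real.sqrt (PpSq (fstSlot l) q)) := by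
  have hc := slotCoef_nonneg cubatureWord (fstSlot l)
  have hF := (abs_form_pairQ_le hS (fstSlot l) p q).trans
    (mul_le_mul_of_nonneg_right (crude_le_nC (fstSlot l)) (by positivity))
  have hee : |ek (fstSlot l) k * ek (sndSlot l) k| ≤ (ek (fstSlot l) k ^ 2 + ek (sndSlot l) k ^ 2) / 2 := by
    rw [abs_mul]
    nlinarith [sq_abs (ek (fstSlot l) k), sq_abs (ek (sndSlot l) k), sq_nonneg (|ek (fstSlot l) k| - |ek (sndSlot l) k|),
      abs_nonneg (ek (fstSlot l) k), abs_nonneg (ek (sndSlot l) k)]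
  rw [abs_mul, abs_mul, abs_of_nonneg hc]
  calc slotCoef cubatureWord (fstSlot l) * |ek (fstSlot l) k * ek (sndSlot l) k| * |∑ i, ∑ j, p i * pairQ S (fstSlot l) i j * q j|
      ≤ slotCoef cubatureWord (fstSlot l) * ((ek (fstSlot l) k ^ 2 + ek (sndSlot l) k ^ 2) / 2)
          * (2 * nC (fstSlot l) * (Real.sqrt (PpSq (fstSlot l) p) * Real.sqrt (PpSq (fstSlot l) q))) :=
        mul_le_mul (mul_le_mul_of_nonneg_left hee hc) hF (abs_nonneg _) (mul_nonneg hc (by positivity))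
    _ = pairW k l * (Real.sqrt (PpSq (fstSlot l) p) * Real.sqrt (PpSq (fstSlot l) q)) := by unfold pairW; ring

/-- (N) is PROVED. -/
theorem stub_pairNum : PairNumBound := by
  intro S hS k p q
  rw [bsymb_pairQS, Nbar_eq_pairs, Nbar_eq_pairs]
  have hsum : |∑ l, slotCoef cubatureWord (fstSlot l) * (ek (fstSlot l) k * ek (sndSlot l) k) *
      ∑ i, ∑ j, p i * pairQ S (fstSlot l) i j * q j|
        ≤ ∑ l, pairW k l * (Real.sqrt (PpSq (fstSlot l) p) * Real.sqrt (PpSq (fstSlot l) q)) :=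
    (Finset.abs_sum_le_sum_abs _ _).trans (Finset.sum_le_sum fun l _ => pair_term_le hS k p q l)
  have hCS : (∑ l, pairW k l * (Real.sqrt (PpSq (fstSlot l) p) * Real.sqrt (PpSq (fstSlot l) q))) ^ 2
      ≤ (∑ l, pairW k l * PpSq (fstSlot l) p) * (∑ l, pairW k l * PpSq (fstSlot l) q) := by
    have h := Finset.sum_mul_sq_le_sq_mul_sq Finset.univ
      (fun l => Real.sqrt (pairW k l) * Real.sqrt (PpSq (fstSlot l) p))
      (fun l => Real.sqrt (pairW k l) * Real.sqrt (PpSq (fstSlot l) q))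
    have e1 : ∑ l, Real.sqrt (pairW k l) * Real.sqrt (PpSq (fstSlot l) p) * (Real.sqrt (pairW k l) * Real.sqrt (PpSq (fstSlot l) q))
        = ∑ l, pairW k l * (Real.sqrt (PpSq (fstSlot l) p) * Real.sqrt (PpSq (fstSlot l) q)) :=
      Finset.sum_congr rfl fun l _ => by
        calc _ = Real.sqrt (pairW k l) * Real.sqrt (pairW k l) * (Real.sqrt (PpSq (fstSlot l) p) * Real.sqrt (PpSq (fstSlot l) q)) := by
              ring
          _ = _ := by rw [Real.mul_self_sqrt (pairW_nonneg k l)]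
    have e2 : ∀ r : Fin 3 → ℝ, ∑ l, (Real.sqrt (pairW k l) * Real.sqrt (PpSq (fstSlot l) r)) ^ 2 = ∑ l, pairW k l * PpSq (fstSlot l) r :=
      fun r => Finset.sum_congr rfl fun l _ => by
        rw [mul_pow, Real.sq_sqrt (pairW_nonneg k l), Real.sq_sqrt (PpSq_nonneg _ _)]
    rw [e1, e2, e2] at h
    exact h
  calc (∑ l, slotCoef cubatureWord (fstSlot l) * (ek (fstSlot l) k * ek (sndSlot l) k) *
          ∑ i, ∑ j, p i * pairQ S (fstSlot l) i j * q j) ^ 2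
      = |∑ l, slotCoef cubatureWord (fstSlot l) * (ek (fstSlot l) k * ek (sndSlot l) k) *
          ∑ i, ∑ j, p i * pairQ S (fstSlot l) i j * q j| ^ 2 := (sq_abs _).symm
    _ ≤ (∑ l, pairW k l * (Real.sqrt (PpSq (fstSlot l) p) * Real.sqrt (PpSq (fstSlot l) q))) ^ 2 :=
        pow_le_pow_left₀ (abs_nonneg _) hsum 2
    _ ≤ _ := hCS

end PairNum

/-- Generic lower point enclosure at `a = 11/10` with the 3 % charge: monotonicity of `ϑ(½,·)` + `le_slotWeight_half` at a rational `X_lo ≥ 30`. -/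
private theorem encl_aux {c Xlo L : ℝ} (hXlo30 : 30 ≤ Xlo) (hXlo : Xlo ≤ c * π ^ 2)
    (hL : L ≤ 97 / 100 * ((1 / 3 - 4 / Xlo ^ 2 + 12 / Xlo ^ 3 - 16 * (1 / (27 / 10 : ℝ) ^ 15) / Xlo ^ 3) / (11 / 10))) :
    L ≤ 97 / 100 * (slotWeight (1 / 2) (c * π ^ 2) / (11 / 10)) := by
  have hm := slotWeight_mono (ρ := 1 / 2) (by norm_num) le_rfl (by linarith) hXlo
  have hlow := le_slotWeight_half hXlo30
  refine hL.trans ?_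
  gcongr
  exact hlow.trans hm

/-- (D-encl) is PROVED: `X = T_c·11/10 = (88/25)π², (2816/125)π², (8019/125)π² ≥ 34.74, 222.3, 633.1`. -/
theorem stub_lEncl : LEncl := by
  intro j
  show lC j ≤ 97 / 100 * qsRespScalar (1 / 2) (4 * Real.pi ^ 2 * ‖Torus.latticeVec (slots j).m‖ ^ 2 * MB * ((slots j).τ : ℝ)) (11 / 10)
  rw [norm_sq_m, show (4 * Real.pi ^ 2 * Mq (slots j) * MB * ((slots j).τ : ℝ)) = Tj j from rfl]
  obtain ⟨hlo, -⟩ := pi_sq_bounds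
  rcases slot_class j with hj | hj | hj
  · obtain ⟨hM, hTj, -⟩ := facts100 j hj
    have hl : lC j = 2911 / 10000 := by unfold lC byClass; rw [hM]; norm_num
    rw [hl, hTj]; unfold T100 MB
    rw [qsRespScalar_eq_slotWeight_div (by norm_num : (11 / 10 : ℝ) ≠ 0),
      show 4 * π ^ 2 * 1 * (1 / 50 : ℝ) * 40 * (11 / 10) = 88 / 25 * π ^ 2 by ring]
    exact encl_aux (Xlo := 3474 / 100) (by norm_num) (by nlinarith) (by norm_num)
  · obtain ⟨hM, hTj, -, -, -, -⟩ := facts110 j hj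
    have hl : lC j = 2937 / 10000 := by unfold lC byClass; rw [hM]; norm_num
    rw [hl, hTj]; unfold T110 MB
    rw [qsRespScalar_eq_slotWeight_div (by norm_num : (11 / 10 : ℝ) ≠ 0),
      show 4 * π ^ 2 * 2 * (1 / 50 : ℝ) * 128 * (11 / 10) = 2816 / 125 * π ^ 2 by ring]
    exact encl_aux (Xlo := 2223 / 10) (by norm_num) (by nlinarith) (by norm_num)
  · obtain ⟨hM, hTj, -⟩ := facts111 j hj
    have hl : lC j = 2938 / 10000 := by unfold lC byClass; rw [hM]; norm_num
    rw [hl, hTj]; unfold T111 MB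
    rw [qsRespScalar_eq_slotWeight_div (by norm_num : (11 / 10 : ℝ) ≠ 0),
      show 4 * π ^ 2 * 3 * (1 / 50 : ℝ) * 243 * (11 / 10) = 8019 / 125 * π ^ 2 by ring]
    exact encl_aux (Xlo := 6331 / 10) (by norm_num) (by nlinarith) (by norm_num)

/-- `|P_j p|²` in the `gainForm_div` vocabulary. -/
theorem PpSq_eq' (j : Fin 26) (p : Fin 3 → ℝ) :
    PpSq j p = ∑ i, p i ^ 2 - (∑ i, p i * mhat (cubatureWord.phase j) i) ^ 2 := by
  unfold PpSq; exact sum_sq_projPerp_mulVec (sum_mhat_sq _) p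

/-- (D) from (D-encl): the denominator bound is the landed first-order sectorial pinch at the design point, slot by slot. -/
theorem excDen_of_lEncl (hE : LEncl) : ExcDenBound := by
  intro S hS τ hτ hodd k p
  have h := (OddGain.evenPinch_excQS_design_point' (Mlag := MB) (le_of_eq rfl) ⟨hτ.1, hτ.2.trans (by norm_num)⟩ hS hodd k p).1
  refine le_trans ?_ h
  rw [gainForm_div cubatureWord MB (by norm_num : (11 / 10 : ℝ) ≠ 0) k p, Finset.mul_sum]
  unfold Lbar
  refine Finset.sum_le_sum fun j _ => ?_
  have hw : 0 ≤ slotCoef cubatureWord j * ek j k ^ 2 * PpSq j p :=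
    mul_nonneg (mul_nonneg (slotCoef_nonneg _ _) (sq_nonneg _)) (PpSq_nonneg j p)
  have hEj := hE j
  unfold slotT at hEj
  calc slotCoef cubatureWord j * ek j k ^ 2 * (lC j * PpSq j p)
      = (slotCoef cubatureWord j * ek j k ^ 2 * PpSq j p) * lC j := by ring
    _ ≤ (slotCoef cubatureWord j * ek j k ^ 2 * PpSq j p) *
          (97 / 100 * qsRespScalar cubatureWord.ramp
            (4 * Real.pi ^ 2 * ‖Torus.latticeVec (cubatureWord.phase j).m‖ ^ 2 * MB * (cubatureWord.phase j).τ) (11 / 10)) :=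
        mul_le_mul_of_nonneg_left hEj hw
    _ = _ := by rw [PpSq_eq']; unfold ek; ring

theorem stub_excDen : ExcDenBound := excDen_of_lEncl stub_lEncl

private theorem div_le_mul_div {A B C r : ℝ} (h : A ≤ r * B) (hC : 0 < C) : A / C ≤ r * (B / C) := by
  rw [← mul_div_assoc]; exact div_le_div_of_nonneg_right h hC.le

/-- (C) is PROVED: the O_h-reduced finite core is two rational sign conditions. -/
theorem stub_core : CoreIneq := by
  intro k p hp
  have hCpos : (0:ℝ) < 2 * (2 * π) ^ 4 * 3720 := by positivity
  have hk : ∀ j, slotCoef cubatureWord j * ek j k ^ 2 = kCoef (slots j) k / (2 * (2 * π) ^ 4 * 3720) := fun j => by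
    unfold ek; exact slotCoef_mul_sq j k
  have hsum : ∀ X1 X2 X3 : ℝ, ∑ j, slotCoef cubatureWord j * ek j k ^ 2 * (byClass X1 X2 X3 (Mq (slots j)) * PpSq j p)
      = ((80 * X1 + 192 * (X2 / 2) + 144 * (X3 / 3) + 64 * 0) * I1 k p + (40 * X1 + 160 * (X2 / 2) + 144 * (X3 / 3) + 32 * 0) * I2 k p
          + (64 * (X2 / 2) + 72 * (X3 / 3)) * I3 k p) / (2 * (2 * π) ^ 4 * 3720) := by
    intro X1 X2 X3
    rw [← slot_sum_poly X1 (X2 / 2) (X3 / 3) 0 k p, Finset.sum_div]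
    refine Finset.sum_congr rfl fun j _ => ?_
    rw [byClass_mul_PpSq, hk j]; ring
  have hN : Nbar k p = _ := hsum (93 / 1000000) (36 / 100000000) (16 / 1000000000)
  have hL : Lbar k p = _ := hsum (2911 / 10000) (2937 / 10000) (2938 / 10000)
  rw [hN, hL, I3_eq_of_perp hp]
  refine div_le_mul_div ?_ hCpos
  have h1 := I1_nonneg k p
  have h2 := I1_le_I2_of_perp hp
  unfold ρP
  nlinarith [h1, h2]

/-! ## §4 Composition (kernel-checked, no sorry) -/

/-- CERT-(i) v0: the pair-memory term is `RelSmall` of size `ρP = 115/10⁶` relative to the quasi-static excess on the sectorial block window. -/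
theorem relSmall_pairQS_of (hN : PairNumBound) (hD : ExcDenBound) (hC : CoreIneq) :
    ∀ S : T4, Torus.NearIso S (10 / 11) (11 / 10) → ∀ τ ∈ Set.Icc (0:ℝ) (1 / 20), OddSectorial S τ →
      RelSmall (pairQS S) (excQS cubatureWord MB S) ρP := by
  intro S hS τ hτ hodd k p q hp hq
  have h1 := hN S hS k p q
  have hρ : (0:ℝ) ≤ ρP := by unfold ρP; norm_num
  have hSp : Nbar k p ≤ ρP * Torus.symb (excQS cubatureWord MB S) k p :=
    (hC k p hp).trans (mul_le_mul_of_nonneg_left (hD S hS τ hτ hodd k p) hρ)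
  have hSq : Nbar k q ≤ ρP * Torus.symb (excQS cubatureWord MB S) k q :=
    (hC k q hq).trans (mul_le_mul_of_nonneg_left (hD S hS τ hτ hodd k q) hρ)
  calc (Torus.bsymb (pairQS S) k p q) ^ 2 ≤ Nbar k p * Nbar k q := h1
    _ ≤ (ρP * Torus.symb (excQS cubatureWord MB S) k p) * (ρP * Torus.symb (excQS cubatureWord MB S) k q) :=
        mul_le_mul hSp hSq (Nbar_nonneg k q) ((Nbar_nonneg k p).trans hSp)
    _ = ρP ^ 2 * (Torus.symb (excQS cubatureWord MB S) k p * Torus.symb (excQS cubatureWord MB S) k q) := by ring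

/-- **THE CERTIFICATE** (unconditional, sorry-free since v3). -/
theorem relSmall_pairQS :
    ∀ S : T4, Torus.NearIso S (10 / 11) (11 / 10) → ∀ τ ∈ Set.Icc (0:ℝ) (1 / 20), OddSectorial S τ →
      RelSmall (pairQS S) (excQS cubatureWord MB S) ρP :=
  relSmall_pairQS_of stub_pairNum stub_excDen stub_core

/-! ## §5 Glue to clause (i): scaling, additivity, assembly with the tail -/

/-- `RelSmall` is invariant under a common scaling of residue and reference. [folklore] -/
theorem RelSmall.smul' {R A : T4} {ρ : ℝ} (h : RelSmall R A ρ) (a : ℝ) : RelSmall (a • R) (a • A) ρ := by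
  intro k p q hp hq
  rw [Torus.bsymb_smul, Torus.symb_smul, Torus.symb_smul]
  have := mul_le_mul_of_nonneg_left (h k p q hp hq) (sq_nonneg a)
  calc (a * Torus.bsymb R k p q) ^ 2 = a ^ 2 * (Torus.bsymb R k p q) ^ 2 := by ring
    _ ≤ a ^ 2 * (ρ ^ 2 * (Torus.symb A k p * Torus.symb A k q)) := this
    _ = ρ ^ 2 * ((a * Torus.symb A k p) * (a * Torus.symb A k q)) := by ring

/-- `RelSmall` is additive in the residue (geometric-mean form) over a transversally nonnegative reference. [folklore] -/
theorem RelSmall.add' {R₁ R₂ A : T4} {ρ₁ ρ₂ : ℝ} (hA : TransNonneg A) (h₁ : RelSmall R₁ A ρ₁) (h₂ : RelSmall R₂ A ρ₂)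
    (hρ₁ : 0 ≤ ρ₁) (hρ₂ : 0 ≤ ρ₂) : RelSmall (R₁ + R₂) A (ρ₁ + ρ₂) := by
  intro k p q hp hq
  rw [Torus.bsymb_add]
  have hP0 : 0 ≤ Torus.symb A k p * Torus.symb A k q := mul_nonneg (hA k p hp) (hA k q hq)
  set P := Torus.symb A k p * Torus.symb A k q with hP
  have hs : Real.sqrt P ^ 2 = P := Real.sq_sqrt hP0
  have e1 : (Torus.bsymb R₁ k p q) ^ 2 ≤ (ρ₁ * Real.sqrt P) ^ 2 := by
    rw [mul_pow, hs]; exact h₁ k p q hp hq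
  have e2 : (Torus.bsymb R₂ k p q) ^ 2 ≤ (ρ₂ * Real.sqrt P) ^ 2 := by
    rw [mul_pow, hs]; exact h₂ k p q hp hq
  have a1 : |Torus.bsymb R₁ k p q| ≤ ρ₁ * Real.sqrt P := abs_le_of_sq_le_sq e1 (mul_nonneg hρ₁ (Real.sqrt_nonneg _))
  have a2 : |Torus.bsymb R₂ k p q| ≤ ρ₂ * Real.sqrt P := abs_le_of_sq_le_sq e2 (mul_nonneg hρ₂ (Real.sqrt_nonneg _))
  have a12 : |Torus.bsymb R₁ k p q + Torus.bsymb R₂ k p q| ≤ (ρ₁ + ρ₂) * Real.sqrt P := by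
    calc |Torus.bsymb R₁ k p q + Torus.bsymb R₂ k p q| ≤ |Torus.bsymb R₁ k p q| + |Torus.bsymb R₂ k p q| := abs_add_le _ _
      _ ≤ ρ₁ * Real.sqrt P + ρ₂ * Real.sqrt P := add_le_add a1 a2
      _ = (ρ₁ + ρ₂) * Real.sqrt P := by ring
  have hb := abs_le.mp a12
  calc (Torus.bsymb R₁ k p q + Torus.bsymb R₂ k p q) ^ 2 ≤ ((ρ₁ + ρ₂) * Real.sqrt P) ^ 2 := sq_le_sq' hb.1 hb.2
    _ = (ρ₁ + ρ₂) ^ 2 * P := by rw [mul_pow, hs]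

/-- ASSEMBLY OF CLAUSE (i): if the pair term is certified at `ρP` (this file) and the remainder of the exact family after removing
`ΦB a S + a • pairQS S` (the TAIL: non-adjacent memory, period wrap, identification residue) is `RelSmall` of size `ρB − ρP`
relative to `ΦB a S`, then clause (i) of `D1ExactFamily (ΦB a) ρB MB MB_pos` holds for `Ψ`.  (`ρB − ρP = 5/10⁶` since v2.) -/
theorem clause_i_of_pair_tail {Ψ : ℝ → T4 → T4} {a : ℝ} (ha : 0 ≤ a)
    (hP : ∀ S : T4, Torus.NearIso S (10 / 11) (11 / 10) → ∀ τ ∈ Set.Icc (0:ℝ) (1 / 20), OddSectorial S τ →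
      RelSmall (pairQS S) (excQS cubatureWord MB S) ρP)
    (hT : ∀ ν : ℝ, ∀ S : T4, Torus.NearIso S (10 / 11) (11 / 10) → ∀ τ ∈ Set.Icc (0:ℝ) (1 / 20), OddSectorial S τ →
      RelSmall (Ψ ν S - ΦB a S - a • pairQS S) (ΦB a S) (ρB - ρP)) :
    ∀ ν : ℝ, ∀ S : T4, Torus.NearIso S (10 / 11) (11 / 10) → ∀ τ ∈ Set.Icc (0:ℝ) (1 / 20), OddSectorial S τ →
      RelSmall (Ψ ν S - ΦB a S) (ΦB a S) ρB := by
  intro ν S hS τ hτ hodd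
  have hA : TransNonneg (ΦB a S) := transNonneg_ΦB ha hS hτ hodd
  have h1 : RelSmall (a • pairQS S) (ΦB a S) ρP := RelSmall.smul' (hP S hS τ hτ hodd) a
  have h2 := hT ν S hS τ hτ hodd
  have hρP : (0:ℝ) ≤ ρP := by unfold ρP; norm_num
  have hρT : (0:ℝ) ≤ ρB - ρP := by unfold ρB ρP; norm_num
  have h := RelSmall.add' hA h1 h2 hρP hρT
  have e : a • pairQS S + (Ψ ν S - ΦB a S - a • pairQS S) = Ψ ν S - ΦB a S := by abel
  rw [e, show ρP + (ρB - ρP) = ρB by ring] at h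
  exact h

/-- The same with the pair certificate discharged (sorry-free): clause (i) of `D1ExactFamily (ΦB a) ρB MB MB_pos` from the TAIL bound ALONE. -/
theorem clause_i_of_tail {Ψ : ℝ → T4 → T4} {a : ℝ} (ha : 0 ≤ a)
    (hT : ∀ ν : ℝ, ∀ S : T4, Torus.NearIso S (10 / 11) (11 / 10) → ∀ τ ∈ Set.Icc (0:ℝ) (1 / 20), OddSectorial S τ →
      RelSmall (Ψ ν S - ΦB a S - a • pairQS S) (ΦB a S) (ρB - ρP)) :
    ∀ ν : ℝ, ∀ S : T4, Torus.NearIso S (10 / 11) (11 / 10) → ∀ τ ∈ Set.Icc (0:ℝ) (1 / 20), OddSectorial S τ →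
      RelSmall (Ψ ν S - ΦB a S) (ΦB a S) ρB :=
  clause_i_of_pair_tail ha relSmall_pairQS hT

/-! ## §6 Tail socket (for the v17 item `stub_D1_residueTail`, p1 g12 lane A4): any tensor whose bilinear symbol is dominated by `ε·N̄` on
transverse pairs is `RelSmall` of size `ε·ρP` relative to the quasi-static excess — the wrap-around / revisit memory terms of the exact family have
exactly the slot shape of `N̄` with an extra factor `e^{−(decay)}`, so their certificate is this lemma with a tiny `ε`. -/

/-- Cauchy–Schwarz in the slot-weighted form: `|b| ≤ Σ_j c_j (e_j·k)² nC_j √|P_j p|² √|P_j q|² ⇒ b² ≤ N̄(k,p)·N̄(k,q)`. -/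
theorem sq_le_Nbar_mul_Nbar {b : ℝ} {k p q : Fin 3 → ℝ}
    (h : |b| ≤ ∑ j, slotCoef cubatureWord j * ek j k ^ 2 * nC j * (Real.sqrt (PpSq j p) * Real.sqrt (PpSq j q))) :
    b ^ 2 ≤ Nbar k p * Nbar k q := by
  have hw : ∀ j : Fin 26, 0 ≤ slotCoef cubatureWord j * ek j k ^ 2 * nC j :=
    fun j => mul_nonneg (mul_nonneg (slotCoef_nonneg cubatureWord j) (sq_nonneg _)) (nC_pos j).le
  have hCS := Finset.sum_mul_sq_le_sq_mul_sq Finset.univ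
      (fun j => Real.sqrt (slotCoef cubatureWord j * ek j k ^ 2 * nC j) * Real.sqrt (PpSq j p))
      (fun j => Real.sqrt (slotCoef cubatureWord j * ek j k ^ 2 * nC j) * Real.sqrt (PpSq j q))
  have e1 : ∑ j, Real.sqrt (slotCoef cubatureWord j * ek j k ^ 2 * nC j) * Real.sqrt (PpSq j p)
        * (Real.sqrt (slotCoef cubatureWord j * ek j k ^ 2 * nC j) * Real.sqrt (PpSq j q))
      = ∑ j, slotCoef cubatureWord j * ek j k ^ 2 * nC j * (Real.sqrt (PpSq j p) * Real.sqrt (PpSq j q)) :=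
    Finset.sum_congr rfl fun j _ => by
      calc _ = Real.sqrt (slotCoef cubatureWord j * ek j k ^ 2 * nC j) * Real.sqrt (slotCoef cubatureWord j * ek j k ^ 2 * nC j)
              * (Real.sqrt (PpSq j p) * Real.sqrt (PpSq j q)) := by ring
        _ = _ := by rw [Real.mul_self_sqrt (hw j)]
  have e2 : ∀ r : Fin 3 → ℝ, ∑ j, (Real.sqrt (slotCoef cubatureWord j * ek j k ^ 2 * nC j) * Real.sqrt (PpSq j r)) ^ 2
      = Nbar k r := fun r => by
    unfold Nbar
    exact Finset.sum_congr rfl fun j _ => by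
      rw [mul_pow, Real.sq_sqrt (hw j), Real.sq_sqrt (PpSq_nonneg _ _)]; ring
  rw [e1, e2, e2] at hCS
  calc b ^ 2 = |b| ^ 2 := (sq_abs _).symm
    _ ≤ (∑ j, slotCoef cubatureWord j * ek j k ^ 2 * nC j * (Real.sqrt (PpSq j p) * Real.sqrt (PpSq j q))) ^ 2 :=
        pow_le_pow_left₀ (abs_nonneg _) h 2
    _ ≤ _ := hCS

/-- **TAIL SOCKET.** On the sectorial block window, `bsymb R(k;p,q)² ≤ ε²·N̄(k,p)·N̄(k,q)` on transverse pairs implies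
`RelSmall R (excQS cubatureWord MB S) (ε·ρP)`. (`relSmall_pairQS` is the case `R = pairQS S`, `ε = 1`.) -/
theorem relSmall_of_Nbar {R S : T4} {ε : ℝ} (hS : Torus.NearIso S (10 / 11) (11 / 10)) {τ : ℝ}
    (hτ : τ ∈ Set.Icc (0:ℝ) (1 / 20)) (hodd : OddSectorial S τ)
    (hR : ∀ k p q : Fin 3 → ℝ, ∑ i, p i * k i = 0 → ∑ i, q i * k i = 0 →
      (Torus.bsymb R k p q) ^ 2 ≤ ε ^ 2 * (Nbar k p * Nbar k q)) :
    RelSmall R (excQS cubatureWord MB S) (ε * ρP) := by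
  intro k p q hp hq
  have hρ : (0:ℝ) ≤ ρP := by unfold ρP; norm_num
  have hSp : Nbar k p ≤ ρP * Torus.symb (excQS cubatureWord MB S) k p :=
    (stub_core k p hp).trans (mul_le_mul_of_nonneg_left (stub_excDen S hS τ hτ hodd k p) hρ)
  have hSq : Nbar k q ≤ ρP * Torus.symb (excQS cubatureWord MB S) k q :=
    (stub_core k q hq).trans (mul_le_mul_of_nonneg_left (stub_excDen S hS τ hτ hodd k q) hρ)
  calc (Torus.bsymb R k p q) ^ 2 ≤ ε ^ 2 * (Nbar k p * Nbar k q) := hR k p q hp hq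
    _ ≤ ε ^ 2 * ((ρP * Torus.symb (excQS cubatureWord MB S) k p) * (ρP * Torus.symb (excQS cubatureWord MB S) k q)) :=
        mul_le_mul_of_nonneg_left (mul_le_mul hSp hSq (Nbar_nonneg k q) ((Nbar_nonneg k p).trans hSp)) (sq_nonneg _)
    _ = (ε * ρP) ^ 2 * (Torus.symb (excQS cubatureWord MB S) k p * Torus.symb (excQS cubatureWord MB S) k q) := by ring

/-- `RelSmall` depends on `R` only through its bilinear symbol (orientation / presentation bridge for the identification of the pair term). -/
theorem RelSmall.of_bsymb_eq {R R' A : T4} {ρ : ℝ} (h : RelSmall R A ρ)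
    (hRR' : ∀ k p q : Fin 3 → ℝ, Torus.bsymb R' k p q = Torus.bsymb R k p q) : RelSmall R' A ρ := by
  intro k p q hp hq; rw [hRR']; exact h k p q hp hq

/-- `RelSmall` is symmetric in the two polarisations: a transposed presentation `bsymb R'(k;p,q) = bsymb R(k;q,p)` is certified too. -/
theorem RelSmall.of_bsymb_swap {R R' A : T4} {ρ : ℝ} (h : RelSmall R A ρ)
    (hRR' : ∀ k p q : Fin 3 → ℝ, Torus.bsymb R' k p q = Torus.bsymb R k q p) : RelSmall R' A ρ := by
  intro k p q hp hq; rw [hRR', mul_comm (Torus.symb A k p)]; exact h k q p hq hp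

/-- `RelSmall` is invariant under `R ↦ −R` (sign of the identification immaterial). -/
theorem RelSmall.neg' {R A : T4} {ρ : ℝ} (h : RelSmall R A ρ) : RelSmall (-R) A ρ := by
  intro k p q hp hq
  have e : Torus.bsymb (-R) k p q = -Torus.bsymb R k p q := by
    have := Torus.bsymb_smul (-1 : ℝ) R k p q
    simp only [neg_one_smul, neg_one_mul] at this
    exact this
  rw [e, neg_sq]; exact h k p q hp hq

end

end Summit.AnomalousDissipation.AnomalousDissipation.Cruxes.LagrangianRenormalisationStep.D1ResidueCert
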